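import Summits.Ventures.Crystal3D.Theorems.StickyWulffConstantCoaxialWallLawTwinDozenNormal
import HarnessLib

/-!
# The word automaton of the co-axial cell, I: the move map is injective (abstract classes)

HONEST FRAMING. Part of the venture `Summits/Ventures/Crystal3D` (cell `crystal3d-full`), helper for the
crux `CoaxialWallLaw` (stmt-Ventures-19481) of `route-Ventures-StickyWulffConstant`, REGISTERED line
`WallLedgerF` (planner cf-p1 gen 16), open stub `stub_coaxialTwoSlabAdhesion` (general fillings).  Brick W1 of
the v2 (NET) line automaton (memo F-NET-AUTOMATON-v2 §7, evidence on the crux item).  Rung credit only; F-C1 not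
moved.

ABSTRACT CLASSES.  `K` any type of class labels, frames `F : K → (ℝ³ ≃ₗᵢ ℝ³)`, one direction `d κ = F κ u_κ`
per class, and a class change `next κ m` along every CROSSING NORMAL `m` of `κ` (unit, slot menu
`⟪F κ w, m⟫ ∈ {0, ±√(2/3)}`, `⟪d κ, m⟫ = +√(2/3)`) such that `F (next κ m) = M_m ∘ F κ` (the `{111}` mirror),
`next (next κ m) m = κ`, and `⟪d (next κ m), m⟫ = +√(2/3)`.  A state is `(b, κ)`; the states of the finite set
`V` satisfy `b − d κ ∈ X` (the line arrived along its own direction).  The move map `f` sends a state whose ball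
has a FULL `F κ`-shell to `(b + d κ, κ)`, a state whose ball reads as a coherent TWIN DOZEN of `(F κ, m)` (own
closed lower half-dozen and the three mirror balls in `X`, far balls not in `X`) with `⟪d κ, m⟫ = +√(2/3)` to
`(b + d (next κ m), next κ m)` (CROSS), and with `⟪d κ, m⟫ = 0` to `(b + d κ, κ)` (GLIDE).

**Theorem (`word_move_injOn`).**  `f` is injective on the moving states of `V`.  A straight/cross collision
would make `b − d κ` the mirror image of a positive slot at a twin dozen — absent
(`twinDozen_mirror_pos_notMem`); a cross/cross collision gives two readings of one ball with the same mirror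
frame, hence the same normal (`twinDozen_normal_eq`) and, by the involution, the same class.  Also
`twinDozen_normal_eq_self` (one frame, one ball: the normal of a twin-dozen reading is unique), which makes the
move map well defined.  Only `1`-separation of `X` is used.

WHAT THIS IS NOT: not the stub; counting, ends and exits are the next bricks; F-C1 not moved.
-/

noncomputable section

namespace Summit.Ventures.Crystal3D.Theorems

open Summit.Ventures.Crystal3D Finset
open Literature.MathematicalPhysics.StatisticalMechanics (fccStacking)
open scoped InnerProductSpace

variable {X : Finset (EuclideanSpace ℝ (Fin 3))}

/-- **One ball, one frame: the composition plane of a twin-dozen reading is unique.** -/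
theorem twinDozen_normal_eq_self (G : EuclideanSpace ℝ (Fin 3) ≃ₗᵢ[ℝ] EuclideanSpace ℝ (Fin 3))
    {m m' : EuclideanSpace ℝ (Fin 3)} (hm : ‖m‖ = 1) (hm' : ‖m'‖ = 1)
    (hmenu : ∀ w ∈ fccSlots, ⟪G w, m⟫_ℝ = 0 ∨ ⟪G w, m⟫_ℝ = Real.sqrt (2 / 3) ∨ ⟪G w, m⟫_ℝ = -Real.sqrt (2 / 3))
    (hmenu' : ∀ w ∈ fccSlots, ⟪G w, m'⟫_ℝ = 0 ∨ ⟪G w, m'⟫_ℝ = Real.sqrt (2 / 3) ∨ ⟪G w, m'⟫_ℝ = -Real.sqrt (2 / 3))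
    {b : EuclideanSpace ℝ (Fin 3)}
    (hown : ∀ w ∈ fccSlots, ⟪G w, m⟫_ℝ ≤ 0 → b + G w ∈ X)
    (hfar' : ∀ w ∈ fccSlots, 0 < ⟪G w, m'⟫_ℝ → b + G w ∉ X) : m = m' := by
  have hr : 0 < Real.sqrt (2 / 3) := Real.sqrt_pos.2 (by norm_num)
  -- the far triple of `m'` consists of far slots of `m`
  obtain ⟨v₁, hv₁, v₂, hv₂, v₃, hv₃, hn₁, hn₂, hn₃, i12, i13, i23, -, -⟩ := exists_far_frame G hm' hmenu'
  have hpos : ∀ v ∈ fccSlots, ⟪G v, m'⟫_ℝ = Real.sqrt (2 / 3) → ⟪G v, m⟫_ℝ = Real.sqrt (2 / 3) := by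
    intro v hv h
    have habs : b + G v ∉ X := hfar' v hv (by rw [h]; exact hr)
    rcases hmenu v hv with h2 | h2 | h2
    · exact absurd (hown v hv h2.le) habs
    · exact h2
    · exact absurd (hown v hv (by rw [h2]; linarith)) habs
  have hsum := sum_far_inner G hm' hv₁ hv₂ hv₃ hn₁ hn₂ hn₃ i12 i13 i23 m
  rw [hpos v₁ hv₁ hn₁, hpos v₂ hv₂ hn₂, hpos v₃ hv₃ hn₃] at hsum
  have hs6 : Real.sqrt 6 = 3 * Real.sqrt (2 / 3) := by
    rw [show (6 : ℝ) = 3 ^ 2 * (2 / 3) by norm_num, Real.sqrt_mul (by norm_num), Real.sqrt_sq (by norm_num)]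
  have hinner : ⟪m', m⟫_ℝ = 1 := by
    rw [hs6] at hsum
    have : 3 * Real.sqrt (2 / 3) * (⟪m', m⟫_ℝ - 1) = 0 := by linarith
    rcases mul_eq_zero.1 this with h | h
    · linarith
    · linarith
  exact ((inner_eq_one_iff_of_norm_eq_one (𝕜 := ℝ) hm' hm).1 hinner).symm

section Moves

variable {K : Type*} {F : K → (EuclideanSpace ℝ (Fin 3) ≃ₗᵢ[ℝ] EuclideanSpace ℝ (Fin 3))}
  {d : K → EuclideanSpace ℝ (Fin 3)} {next : K → EuclideanSpace ℝ (Fin 3) → K}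
  {V : Finset (EuclideanSpace ℝ (Fin 3) × K)}
  {f : EuclideanSpace ℝ (Fin 3) × K → EuclideanSpace ℝ (Fin 3) × K}

/-- **The move map of the word automaton is injective on the moving states.**  See the module docstring.
The twin-dozen reading `TD κ m b` is spelled out: own closed lower half-dozen in `X`, mirror balls of the
negative slots in `X`, far balls not in `X`. -/
theorem word_move_injOn (hX : ∀ p ∈ X, ∀ q ∈ X, p ≠ q → 1 ≤ dist p q)
    (hd : ∀ κ, ∃ u ∈ fccSlots, d κ = F κ u)
    (hmirror : ∀ κ (m : EuclideanSpace ℝ (Fin 3)), ‖m‖ = 1 →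
      (∀ w ∈ fccSlots, ⟪F κ w, m⟫_ℝ = 0 ∨ ⟪F κ w, m⟫_ℝ = Real.sqrt (2 / 3) ∨ ⟪F κ w, m⟫_ℝ = -Real.sqrt (2 / 3)) →
      ⟪d κ, m⟫_ℝ = Real.sqrt (2 / 3) → ∀ x, F (next κ m) x = F κ x - (2 * ⟪F κ x, m⟫_ℝ) • m)
    (hinv : ∀ κ (m : EuclideanSpace ℝ (Fin 3)), ‖m‖ = 1 →
      (∀ w ∈ fccSlots, ⟪F κ w, m⟫_ℝ = 0 ∨ ⟪F κ w, m⟫_ℝ = Real.sqrt (2 / 3) ∨ ⟪F κ w, m⟫_ℝ = -Real.sqrt (2 / 3)) →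
      ⟪d κ, m⟫_ℝ = Real.sqrt (2 / 3) → next (next κ m) m = κ)
    (hdnext : ∀ κ (m : EuclideanSpace ℝ (Fin 3)), ‖m‖ = 1 →
      (∀ w ∈ fccSlots, ⟪F κ w, m⟫_ℝ = 0 ∨ ⟪F κ w, m⟫_ℝ = Real.sqrt (2 / 3) ∨ ⟪F κ w, m⟫_ℝ = -Real.sqrt (2 / 3)) →
      ⟪d κ, m⟫_ℝ = Real.sqrt (2 / 3) → ⟪d (next κ m), m⟫_ℝ = Real.sqrt (2 / 3))
    (hV : ∀ v ∈ V, v.1 - d v.2 ∈ X)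
    (hf_full : ∀ v ∈ V, (∀ w ∈ fccSlots, v.1 + F v.2 w ∈ X) → f v = (v.1 + d v.2, v.2))
    (hf_cross : ∀ v ∈ V, ∀ m : EuclideanSpace ℝ (Fin 3), ‖m‖ = 1 →
      (∀ w ∈ fccSlots, ⟪F v.2 w, m⟫_ℝ = 0 ∨ ⟪F v.2 w, m⟫_ℝ = Real.sqrt (2 / 3) ∨ ⟪F v.2 w, m⟫_ℝ = -Real.sqrt (2 / 3)) →
      (∀ w ∈ fccSlots, ⟪F v.2 w, m⟫_ℝ ≤ 0 → v.1 + F v.2 w ∈ X) →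
      (∀ w ∈ fccSlots, ⟪F v.2 w, m⟫_ℝ < 0 → v.1 + (F v.2 w - (2 * ⟪F v.2 w, m⟫_ℝ) • m) ∈ X) →
      (∀ w ∈ fccSlots, 0 < ⟪F v.2 w, m⟫_ℝ → v.1 + F v.2 w ∉ X) →
      ⟪d v.2, m⟫_ℝ = Real.sqrt (2 / 3) → f v = (v.1 + d (next v.2 m), next v.2 m))
    (hf_glide : ∀ v ∈ V, ∀ m : EuclideanSpace ℝ (Fin 3), ‖m‖ = 1 →
      (∀ w ∈ fccSlots, ⟪F v.2 w, m⟫_ℝ = 0 ∨ ⟪F v.2 w, m⟫_ℝ = Real.sqrt (2 / 3) ∨ ⟪F v.2 w, m⟫_ℝ = -Real.sqrt (2 / 3)) →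
      (∀ w ∈ fccSlots, ⟪F v.2 w, m⟫_ℝ ≤ 0 → v.1 + F v.2 w ∈ X) →
      (∀ w ∈ fccSlots, ⟪F v.2 w, m⟫_ℝ < 0 → v.1 + (F v.2 w - (2 * ⟪F v.2 w, m⟫_ℝ) • m) ∈ X) →
      (∀ w ∈ fccSlots, 0 < ⟪F v.2 w, m⟫_ℝ → v.1 + F v.2 w ∉ X) →
      ⟪d v.2, m⟫_ℝ = 0 → f v = (v.1 + d v.2, v.2)) :
    Set.InjOn f {v | v ∈ V ∧ ((∀ w ∈ fccSlots, v.1 + F v.2 w ∈ X) ∨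
      ∃ m : EuclideanSpace ℝ (Fin 3), ‖m‖ = 1 ∧
        (∀ w ∈ fccSlots, ⟪F v.2 w, m⟫_ℝ = 0 ∨ ⟪F v.2 w, m⟫_ℝ = Real.sqrt (2 / 3) ∨ ⟪F v.2 w, m⟫_ℝ = -Real.sqrt (2 / 3)) ∧
        (∀ w ∈ fccSlots, ⟪F v.2 w, m⟫_ℝ ≤ 0 → v.1 + F v.2 w ∈ X) ∧
        (∀ w ∈ fccSlots, ⟪F v.2 w, m⟫_ℝ < 0 → v.1 + (F v.2 w - (2 * ⟪F v.2 w, m⟫_ℝ) • m) ∈ X) ∧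
        (∀ w ∈ fccSlots, 0 < ⟪F v.2 w, m⟫_ℝ → v.1 + F v.2 w ∉ X) ∧
        (⟪d v.2, m⟫_ℝ = Real.sqrt (2 / 3) ∨ ⟪d v.2, m⟫_ℝ = 0))} := by
  have hr : 0 < Real.sqrt (2 / 3) := Real.sqrt_pos.2 (by norm_num)
  -- the shape of the image of a moving state: STRAIGHT `(b + d κ, κ)` or CROSS along a reading `m`
  have hshape : ∀ v ∈ V, ((∀ w ∈ fccSlots, v.1 + F v.2 w ∈ X) ∨
      ∃ m : EuclideanSpace ℝ (Fin 3), ‖m‖ = 1 ∧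
        (∀ w ∈ fccSlots, ⟪F v.2 w, m⟫_ℝ = 0 ∨ ⟪F v.2 w, m⟫_ℝ = Real.sqrt (2 / 3) ∨ ⟪F v.2 w, m⟫_ℝ = -Real.sqrt (2 / 3)) ∧
        (∀ w ∈ fccSlots, ⟪F v.2 w, m⟫_ℝ ≤ 0 → v.1 + F v.2 w ∈ X) ∧
        (∀ w ∈ fccSlots, ⟪F v.2 w, m⟫_ℝ < 0 → v.1 + (F v.2 w - (2 * ⟪F v.2 w, m⟫_ℝ) • m) ∈ X) ∧
        (∀ w ∈ fccSlots, 0 < ⟪F v.2 w, m⟫_ℝ → v.1 + F v.2 w ∉ X) ∧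
        (⟪d v.2, m⟫_ℝ = Real.sqrt (2 / 3) ∨ ⟪d v.2, m⟫_ℝ = 0)) →
      f v = (v.1 + d v.2, v.2) ∨
      ∃ m : EuclideanSpace ℝ (Fin 3), ‖m‖ = 1 ∧
        (∀ w ∈ fccSlots, ⟪F v.2 w, m⟫_ℝ = 0 ∨ ⟪F v.2 w, m⟫_ℝ = Real.sqrt (2 / 3) ∨ ⟪F v.2 w, m⟫_ℝ = -Real.sqrt (2 / 3)) ∧
        (∀ w ∈ fccSlots, ⟪F v.2 w, m⟫_ℝ ≤ 0 → v.1 + F v.2 w ∈ X) ∧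
        (∀ w ∈ fccSlots, ⟪F v.2 w, m⟫_ℝ < 0 → v.1 + (F v.2 w - (2 * ⟪F v.2 w, m⟫_ℝ) • m) ∈ X) ∧
        ⟪d v.2, m⟫_ℝ = Real.sqrt (2 / 3) ∧ f v = (v.1 + d (next v.2 m), next v.2 m) := by
    intro v hv hmv
    by_cases hfull : ∀ w ∈ fccSlots, v.1 + F v.2 w ∈ X
    · exact Or.inl (hf_full v hv hfull)
    · obtain ⟨m, hm, hmenu, hown, hmir, hfar, hdm⟩ := hmv.resolve_left hfull
      rcases hdm with hdm | hdm
      · exact Or.inr ⟨m, hm, hmenu, hown, hmir, hdm, hf_cross v hv m hm hmenu hown hmir hfar hdm⟩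
      · exact Or.inl (hf_glide v hv m hm hmenu hown hmir hfar hdm)
  -- a straight image and a cross image never coincide
  have hSC : ∀ v ∈ V, ∀ v' ∈ V, ∀ m : EuclideanSpace ℝ (Fin 3), ‖m‖ = 1 →
      (∀ w ∈ fccSlots, ⟪F v'.2 w, m⟫_ℝ = 0 ∨ ⟪F v'.2 w, m⟫_ℝ = Real.sqrt (2 / 3) ∨ ⟪F v'.2 w, m⟫_ℝ = -Real.sqrt (2 / 3)) →
      (∀ w ∈ fccSlots, ⟪F v'.2 w, m⟫_ℝ ≤ 0 → v'.1 + F v'.2 w ∈ X) →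
      ⟪d v'.2, m⟫_ℝ = Real.sqrt (2 / 3) →
      (v.1 + d v.2, v.2) ≠ (v'.1 + d (next v'.2 m), next v'.2 m) := by
    intro v hv v' hv' m hm hmenu' hown' hdm' heq
    obtain ⟨h1, h2⟩ := Prod.mk.inj heq
    -- same class `κ = next κ' m`, hence same direction and same ball
    have hdd : d v.2 = d (next v'.2 m) := by rw [h2]
    have hb : v.1 = v'.1 := by
      have := h1; rw [hdd] at this; exact add_right_cancel this
    -- `d κ = F κ u₀` with `⟪F κ' u₀, m⟫ = −√(2/3)`
    obtain ⟨u₀, hu₀, hdu⟩ := hd v.2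
    have hFm := hmirror v'.2 m hm hmenu' hdm'
    have hdm : ⟪d v.2, m⟫_ℝ = Real.sqrt (2 / 3) := by rw [hdd]; exact hdnext v'.2 m hm hmenu' hdm'
    have hneg : ⟪F v'.2 u₀, m⟫_ℝ = -Real.sqrt (2 / 3) := by
      have h := hdm
      rw [hdu, h2, hFm, inner_sub_left, real_inner_smul_left, real_inner_self_eq_norm_sq, hm] at h
      linarith
    -- so `b − d κ` is the mirror image of the positive slot `−u₀` of `F κ'` at the twin dozen `b`: absent
    have hpos : 0 < ⟪F v'.2 (-u₀), m⟫_ℝ := by rw [map_neg, inner_neg_left, hneg, neg_neg]; exact hr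
    have key := twinDozen_mirror_pos_notMem hX (F v'.2) hm hmenu' hown' (neg_mem_fccSlots hu₀) hpos
    have hval := hV v hv
    rw [hb, hdu, h2, hFm] at hval
    have e : v'.1 + (F v'.2 (-u₀) - (2 * ⟪F v'.2 (-u₀), m⟫_ℝ) • m) =
        v'.1 - (F v'.2 u₀ - (2 * ⟪F v'.2 u₀, m⟫_ℝ) • m) := by
      rw [map_neg, inner_neg_left]
      module
    exact key (by rw [e]; exact hval)
  rintro v ⟨hv, hmv⟩ v' ⟨hv', hmv'⟩ heq
  rcases hshape v hv hmv with hs | ⟨m, hm, hmenu, hown, hmir, hdm, hs⟩ <;>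
    rcases hshape v' hv' hmv' with hs' | ⟨m', hm', hmenu', hown', hmir', hdm', hs'⟩
  · -- straight / straight
    rw [hs, hs'] at heq
    obtain ⟨h1, h2⟩ := Prod.mk.inj heq
    have hb : v.1 = v'.1 := by rw [h2] at h1; exact add_right_cancel h1
    exact Prod.ext hb h2
  · -- straight / cross
    rw [hs, hs'] at heq
    exact absurd heq (hSC v hv v' hv' m' hm' hmenu' hown' hdm')
  · -- cross / straight
    rw [hs, hs'] at heq
    exact absurd heq.symm (hSC v' hv' v hv m hm hmenu hown hdm)
  · -- cross / cross: two readings of one ball with the same mirror frame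
    rw [hs, hs'] at heq
    obtain ⟨h1, h2⟩ := Prod.mk.inj heq
    have hb : v.1 = v'.1 := by rw [h2] at h1; exact add_right_cancel h1
    have hF1 := hmirror v.2 m hm hmenu hdm
    have hF2 := hmirror v'.2 m' hm' hmenu' hdm'
    have hmm : m = m' := by
      refine twinDozen_normal_eq hX (F (next v.2 m)) (F v.2) (F v'.2) hm hm' hmenu hmenu' hF1 ?_ hown ?_ ?_
      · intro x; rw [h2]; exact hF2 x
      · intro w hw h; rw [hb]; exact hown' w hw h
      · intro w hw h; rw [hb]; exact hmir' w hw h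
    subst hmm
    have hκ : v.2 = v'.2 := by
      have e1 := hinv v.2 m hm hmenu hdm
      have e2 := hinv v'.2 m hm' hmenu' hdm'
      rw [← e1, h2, e2]
    exact Prod.ext hb hκ

end Moves

end Summit.Ventures.Crystal3D.Theorems

end
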